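import Summits.HodgeConjecture.HodgeConjecture.Theorems.R90S6TwistedTreeInvolutionFixedRankOne   -- ★ W11 FILE 1b: (T.4) `thetaTreeIso_glVertexAct`, (T.5) `thetaTreeIso_eq_self_iff` (brings ★ FILE 1 `thetaTreeIso`, ★ (W1c)-A `glVertexAct` ∕ `glTreeIso`)
import Summits.HodgeConjecture.HodgeConjecture.Theorems.R90S6TreeDisplacementSphereCount         -- ★ W8-f: `ncard_displaced_eq_of_regular_sum` (brings ★ `TreeDisplacement.exists_height_parent`)
import Summits.HodgeConjecture.HodgeConjecture.Theorems.R90S6ShellSphereDictU2                    -- ★ A1-H (the `U(2)`-tree template): generic `dist_eq_of_adj_chain`; brings ★ `TreeLayers.dist_iso_apply`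
import Literature.NumberTheory.Automorphic.CartanDecompositionGLnPowers                            -- ★ `exists_glInt_mul_mul_eq_zpowDiagGL`, `coe_zpowDiagGL_const` (brings ★ `zpowDiagGL`, `zpowDiagGL_add`, `zpowDiagGL_neg`)
import Literature.NumberTheory.Automorphic.SLTwoTreeVertexLevel                                    -- ★ `level_eq_of_glVertexAct_eq`, `level_data_diagonal_one_pow` (brings ★ `SLTwoTreeTransitive`: `latticeTree_adj_root`, `mapGL_latt_one`)
import Literature.NumberTheory.Automorphic.SLTwoTreeQuadraticTorusShellDecomposition               -- ★ `glVertexAct_root_eq_of_mem_glInt` (`GL₂(𝒪)` fixes the root)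
import HarnessLib

/-!
# R90 · S6 «Ch. 14.1–14.5 stable TF» — card W11, FILE 2: THE TWISTED DISPLACEMENT SHELLS ON THE TREE OF `GL₂(E_w)` («TREE IN TREE», rank one)
# (`Theorems/R90S6TwistedShellCountRankOne.lean`; DAG E1.4.4.3.2)

Cell `hodgecm-mathlib`, crux H413 (`stmt-HodgeConjecture-24833`), route of record `HCCMUnconditional`; programme R90-TF, section S6 (base `R90-C14`),
seat K2Liu-p27 (g4); S6 dealer R90-C14-plan (g2) CARD W11 (02:43:57Z), FILE 2 after ★ FILE 1 `R90S6TwistedTreeInvolutionRankOne` (p864944, the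
involution `θ̄ = thetaTreeIso`) and ★ FILE 1b `R90S6TwistedTreeInvolutionFixedRankOne` (p865048: `Fix θ̄` = the `U(1,1)_w` tree, `θ̄(g•M) = Θ(g)•θ̄M`).
Lane `--supports stmt-HodgeConjecture-24833 --as helper`; THEOREMS ONLY (no definition, no instance, no notation, no named-fact hypothesis, no `sorry`).

THE MATHEMATICS (Rogawski §4.11 pp. 58–60; Langlands, *Base change for GL(2)* §5; Serre, *Trees* II.1).  `X = latticeTree id ϖ J` is the `(q_E+1)`-regular
tree of `GL₂(E)` (vertices = the normalised representatives of the homothety classes of lattices, ★ `SLTwoTreeAsLatticeTree`), on which `GL₂(E)` acts through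
`PGL₂(E)` by `• := glVertexAct hϖ` (★ (W1c)-A) with root `v₀ = [𝒪²]` (binder `hv₀ : v₀.1 = latt 1`).  For `δ ∈ GL₂(E)` the TWISTED DISPLACEMENT MAP is
`τ_δ := δ• ∘ θ̄` (as a graph automorphism: `(thetaTreeIso …).trans (glTreeIso hϖ δ)`; NO new definition — it is spelled out); the twisted orbital integral
`TO_{δθ}(𝟙_{K̃ ϖ^a K̃})` counts the vertices `x = g•v₀` with `g⁻¹ δ Θ(g) ∈ K̃ ϖ^a K̃`, i.e. (this file) with `d(x, τ_δ x) = a₀ − a₁`.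
* §1 «SPHERES = CARTAN SHELLS» on the tree of `GL₂(E)` (the rank-one clone, for the BIG tree, of ★ A1-H `R90S6ShellSphereDictU2`):
  **`dist_root_glVertexAct_zpowDiagGL`** `d(v₀, ϖ^a • v₀) = a₀ − a₁` (`a` antitone) and **`dist_root_glVertexAct_of_mul_mul_eq_zpowDiagGL`**: `k₁ g k₂ = ϖ^a`
  (`kᵢ ∈ GL₂(𝒪)`) ⇒ `d(v₀, g • v₀) = a₀ − a₁`; with ★ `exists_glInt_mul_mul_eq_zpowDiagGL` every `g` has such data (**`exists_antitone_dist_root_glVertexAct_eq`**).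
  Proof: the chain `j ↦ ϖ^{(0,j)} • v₀` is a path (★ `latticeTree_adj_root` transported by ★ `latticeTree_adj_glVertexAct`), injective by the ★ level calculus
  (`level_eq_of_glVertexAct_eq`), hence geodesic (★ `dist_eq_of_adj_chain`); scalars die (★ `glVertexAct_scalar_mul`), `GL₂(𝒪)` fixes `v₀` and acts by isometries.
* §2 THE TWISTED DISPLACEMENT MAP: **`thetaTreeIso_root`** (`θ̄ v₀ = v₀`, no DVR), **`glVertexAct_thetaTreeIso_glVertexAct_thetaTreeIso`** (`τ_δ² = (δ·Θδ)•`, the norm),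
  **`glVertexAct_thetaTreeIso_glVertexAct`** (`τ_δ(g•M) = (δΘ(g)δ⁻¹)•τ_δ M`), **`dist_glVertexAct_root_glVertexAct_thetaTreeIso`** (`d(g•v₀, τ_δ(g•v₀)) = d(v₀, (g⁻¹δΘg)•v₀)`)
  and THE TWISTED SHELL DICTIONARY **`dist_glVertexAct_thetaTreeIso_of_mul_mul_eq_zpowDiagGL`**: `k₁ (g⁻¹δΘ(g)) k₂ = ϖ^a ⇒ d(g•v₀, τ_δ(g•v₀)) = a₀ − a₁`
  (tree edition at `N = 2` of ★ W9-c; the other exponent is forced, `a₀ + a₁ = ord det δ − 2 ord det g`).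
* §3 THE ELLIPTIC TWISTED SHELL COUNT (τ_δ with a fixed vertex `u` and finitely many fixed vertices — the case `ord det δ` even; `Fix τ_δ = ∅` with `τ_δ` elliptic is the
  INVERSION case, FILE 2b on ★ p864951): **`setOf_dist_glVertexAct_thetaTreeIso_eq_odd`** (odd shells are empty, ★ `TreeDisplacement.exists_height_parent`) and
  **`ncard_setOf_dist_glVertexAct_thetaTreeIso_eq_two_mul`**: `#{x : d(x, τ_δ x) = 2k} = q^{k−1} · Σ_{y ∈ Fix τ_δ} #{w ∈ N(y) : τ_δ w ≠ w}` (`k ≥ 1`) — ★ W8-f BY NAME at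
  `α = τ_δ`, the regularity entering as the VALUE BINDER `hdeg` (discharged by ★ `SLTwoTreeRegular.ncard_neighborSet_eq`, `q = q_E = #𝓀[E]`, in the consumer's
  `Valued`-compatible frame; no bridge inside this file).
HONEST LABEL: count layer of E1.4.4.3.2 (the `G̃`-side of the η̂_j clauses, Prop. 4.11.1 (b) ∕ L. 11.5.3), count-neutral until the socket consumes it; proves no printed global
statement; HC_CM is proved only modulo the 7 printed citations (2 remaining named inputs: hLiu418 = stmt-HodgeConjecture-24832, h413 = stmt-HodgeConjecture-24833) until rung 0
closes; REL ≠ ★ ≠ BUILT.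

## References
* [Rogawski1990] J. D. Rogawski, *Automorphic Representations of Unitary Groups in Three Variables*, Ann. of Math. Stud. 123 (1990), §4.9–§4.11 pp. 54–60, L. 11.5.3 p. 155.
* [Langlands1980AMS96] R. P. Langlands, *Base Change for GL(2)*, Ann. of Math. Stud. 96 (1980), §5.
* [Serre1980Trees] J.-P. Serre, *Trees* (1980), Ch. I §6.4 Prop. 24, Ch. II §1.1 Thm. 1, §1.2–§1.3.
* [CartierCorvallis1979] P. Cartier, *Representations of p-adic groups*, Proc. Symp. Pure Math. 33.1 (1979), §IV.2 (Cartan decomposition).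
-/

set_option autoImplicit false
-- the mandated namespace repeats the single-problem summit's segment (`HodgeConjecture.HodgeConjecture`)
set_option linter.dupNamespace false

noncomputable section

open scoped ValuativeRel Matrix MatrixGroups
open Matrix ValuativeRel
open Literature.NumberTheory.Automorphic Literature.NumberTheory.Automorphic.HermitianLatticeTree
open Literature.Combinatorics.SimpleGraph

namespace Summit.HodgeConjecture.HodgeConjecture.R90.S6

variable {E : Type*} [Field E] [ValuativeRel E] {ϖ : E} (hϖ : IsUniformizingElement ϖ)

/-! ## §1 Spheres = Cartan shells on the tree of `GL₂(E)` -/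

section Spheres

variable [IsDiscreteValuationRing 𝒪[E]]

omit [ValuativeRel E] [IsDiscreteValuationRing 𝒪[E]] in
/-- The matrix of `ϖ^{(0, m)}` is `diag(1, ϖ^m)`. [folklore] -/
private theorem coe_zpowDiagGL_zero_nat (h0 : ϖ ≠ 0) (m : ℕ) :
    ((zpowDiagGL h0 ![(0 : ℤ), (m : ℤ)] : GL (Fin 2) E) : Matrix (Fin 2) (Fin 2) E) = Matrix.diagonal ![(1 : E), ϖ ^ m] := by
  rw [coe_zpowDiagGL]
  congr 1
  funext i
  fin_cases i
  · simp
  · simp [zpow_natCast]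

omit [ValuativeRel E] [IsDiscreteValuationRing 𝒪[E]] in
/-- `ϖ^{(0, j+1)} = ϖ^{(0, j)} · ϖ^{(0, 1)}`. [folklore] -/
private theorem zpowDiagGL_zero_succ (h0 : ϖ ≠ 0) (j : ℕ) :
    (zpowDiagGL h0 ![(0 : ℤ), ((j + 1 : ℕ) : ℤ)] : GL (Fin 2) E) = zpowDiagGL h0 ![(0 : ℤ), (j : ℤ)] * zpowDiagGL h0 ![(0 : ℤ), 1] := by
  rw [← zpowDiagGL_add]
  congr 1
  funext i
  fin_cases i <;> simp

omit [ValuativeRel E] [IsDiscreteValuationRing 𝒪[E]] in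
/-- The scalar `ϖ^{(c, c)}` is the homothety `(ϖ^c) • 1`, in the currency of ★ `glVertexAct_scalar_mul`. [folklore] -/
private theorem zpowDiagGL_const_eq_map_scalar (h0 : ϖ ≠ 0) (c : ℤ) :
    (zpowDiagGL h0 (fun _ : Fin 2 => c) : GL (Fin 2) E) =
      ((Units.mk0 ϖ h0) ^ c).map ((Matrix.scalar (Fin 2) : E →+* Matrix (Fin 2) (Fin 2) E) : E →* Matrix (Fin 2) (Fin 2) E) :=
  Units.ext (by rw [coe_zpowDiagGL_const, Units.coe_map, MonoidHom.coe_coe, Units.val_zpow_eq_zpow_val, Units.val_mk0])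

include hϖ in
/-- **THE REFERENCE EDGE, TRANSLATED**: `v₀ ~ ϖ^{(0,1)} • v₀` (`ϖ^{(0,1)} • v₀ = latt diag(1, ϖ)`, ★ `latticeTree_adj_root`). [cite: Serre1980Trees, Ch. II §1.1] -/
private theorem adj_root_glVertexAct_zpowDiagGL_one
    (v₀ : {M : Submodule 𝒪[E] (Fin 2 → E) // IsSpecialLattice (RingHom.id E) ϖ !![(0 : E), 1; -1, 0] M})
    (hv₀ : v₀.1 = latt (1 : Matrix (Fin 2) (Fin 2) E)) :
    (latticeTree (RingHom.id E) ϖ !![(0 : E), 1; -1, 0]).Adj v₀ (glVertexAct hϖ (zpowDiagGL hϖ.ne_zero ![(0 : ℤ), 1]) v₀) := by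
  have h0 := hϖ.ne_zero
  have hT : ((zpowDiagGL h0 ![(0 : ℤ), 1] : GL (Fin 2) E) : Matrix (Fin 2) (Fin 2) E) = Matrix.diagonal ![(1 : E), ϖ] := by
    have h := coe_zpowDiagGL_zero_nat (E := E) h0 1
    rwa [Nat.cast_one, pow_one] at h
  have hdet : valuation E ((zpowDiagGL h0 ![(0 : ℤ), 1] : GL (Fin 2) E) : Matrix (Fin 2) (Fin 2) E).det = valuation E ϖ := by
    rw [hT, Matrix.det_diagonal, Fin.prod_univ_two]
    simp
  let v₁ : {M : Submodule 𝒪[E] (Fin 2 → E) // IsSpecialLattice (RingHom.id E) ϖ !![(0 : E), 1; -1, 0] M} :=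
    ⟨latt (Matrix.diagonal ![(1 : E), ϖ]), Or.inr ((isModularLattice_id_altJ_iff h0 _).2 ⟨zpowDiagGL h0 ![(0 : ℤ), 1], by rw [hT], hdet⟩)⟩
  have hTv : glVertexAct hϖ (zpowDiagGL h0 ![(0 : ℤ), 1]) v₀ = v₁ :=
    (glVertexAct_eq_iff hϖ _ v₀ v₁).2 ⟨0, by rw [zpow_zero, scaleLattice_one, hv₀, mapGL_latt_one, hT]⟩
  rw [hTv]
  exact latticeTree_adj_root hϖ v₀ v₁ hv₀ rfl

include hϖ in
/-- The chain `j ↦ ϖ^{(0,j)} • v₀` consists of consecutive neighbours. [cite: Serre1980Trees, Ch. II §1.1] -/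
private theorem adj_chain_zpowDiagGL
    (v₀ : {M : Submodule 𝒪[E] (Fin 2 → E) // IsSpecialLattice (RingHom.id E) ϖ !![(0 : E), 1; -1, 0] M})
    (hv₀ : v₀.1 = latt (1 : Matrix (Fin 2) (Fin 2) E)) (j : ℕ) :
    (latticeTree (RingHom.id E) ϖ !![(0 : E), 1; -1, 0]).Adj (glVertexAct hϖ (zpowDiagGL hϖ.ne_zero ![(0 : ℤ), (j : ℤ)]) v₀)
      (glVertexAct hϖ (zpowDiagGL hϖ.ne_zero ![(0 : ℤ), ((j + 1 : ℕ) : ℤ)]) v₀) := by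
  rw [zpowDiagGL_zero_succ, glVertexAct_mul]
  exact latticeTree_adj_glVertexAct hϖ _ (adj_root_glVertexAct_zpowDiagGL_one hϖ v₀ hv₀)

include hϖ in
/-- The chain `j ↦ ϖ^{(0,j)} • v₀` is injective (the vertices have different levels, ★ `level_eq_of_glVertexAct_eq`). [cite: Serre1980Trees, Ch. II §1.1] -/
private theorem injective_chain_zpowDiagGL
    (v₀ : {M : Submodule 𝒪[E] (Fin 2 → E) // IsSpecialLattice (RingHom.id E) ϖ !![(0 : E), 1; -1, 0] M})
    (hv₀ : v₀.1 = latt (1 : Matrix (Fin 2) (Fin 2) E)) :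
    Function.Injective fun j : ℕ => glVertexAct hϖ (zpowDiagGL hϖ.ne_zero ![(0 : ℤ), (j : ℤ)]) v₀ := by
  intro i j hij
  have hi := level_data_diagonal_one_pow hϖ (coe_zpowDiagGL_zero_nat hϖ.ne_zero i)
  have hj := level_data_diagonal_one_pow hϖ (coe_zpowDiagGL_zero_nat hϖ.ne_zero j)
  exact level_eq_of_glVertexAct_eq hϖ v₀ hv₀ hij one_ne_zero hi.1 hi.2.1 hi.2.2.1 hi.2.2.2 hj.1 hj.2.1 hj.2.2.1 hj.2.2.2

include hϖ in
/-- **`d(v₀, ϖ^{(0,m)} • v₀) = m`**: the chain `ϖ^{(0,j)} • v₀`, `j ≤ m`, is the geodesic from the root to `[latt diag(1, ϖ^m)]`. [cite: Serre1980Trees, Ch. II §1.1 Thm. 1] -/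
theorem dist_root_glVertexAct_zpowDiagGL_zero_nat
    (v₀ : {M : Submodule 𝒪[E] (Fin 2 → E) // IsSpecialLattice (RingHom.id E) ϖ !![(0 : E), 1; -1, 0] M})
    (hv₀ : v₀.1 = latt (1 : Matrix (Fin 2) (Fin 2) E)) (m : ℕ) :
    (latticeTree (RingHom.id E) ϖ !![(0 : E), 1; -1, 0]).dist v₀ (glVertexAct hϖ (zpowDiagGL hϖ.ne_zero ![(0 : ℤ), (m : ℤ)]) v₀) = m := by
  have h := dist_eq_of_adj_chain (isTree_latticeTree_id_altJ hϖ) (fun j : ℕ => glVertexAct hϖ (zpowDiagGL hϖ.ne_zero ![(0 : ℤ), (j : ℤ)]) v₀)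
    (adj_chain_zpowDiagGL hϖ v₀ hv₀) (injective_chain_zpowDiagGL hϖ v₀ hv₀) m
  have hA0 : glVertexAct hϖ (zpowDiagGL hϖ.ne_zero ![(0 : ℤ), ((0 : ℕ) : ℤ)]) v₀ = v₀ := by
    have h00 : (![(0 : ℤ), ((0 : ℕ) : ℤ)] : Fin 2 → ℤ) = 0 := by
      funext i
      fin_cases i <;> simp
    rw [h00, zpowDiagGL_zero, glVertexAct_one]
  simpa only [hA0] using h

include hϖ in
/-- **`d(v₀, ϖ^a • v₀) = a₀ − a₁`** for antitone `a ∈ ℤ²` (`ϖ^a = ϖ^{a₀} · (ϖ^{(0, a₀−a₁)})⁻¹`: scalars act trivially, ★ `glVertexAct_scalar_mul`, and `g ↦ g•` is an isometry,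
★ `TreeLayers.dist_iso_apply`). [cite: Serre1980Trees, Ch. II §1.1 Thm. 1] [cite: CartierCorvallis1979, §IV.2] -/
theorem dist_root_glVertexAct_zpowDiagGL
    (v₀ : {M : Submodule 𝒪[E] (Fin 2 → E) // IsSpecialLattice (RingHom.id E) ϖ !![(0 : E), 1; -1, 0] M})
    (hv₀ : v₀.1 = latt (1 : Matrix (Fin 2) (Fin 2) E)) {a : Fin 2 → ℤ} (ha : Antitone a) :
    (latticeTree (RingHom.id E) ϖ !![(0 : E), 1; -1, 0]).dist v₀ (glVertexAct hϖ (zpowDiagGL hϖ.ne_zero a) v₀) = (a 0 - a 1).toNat := by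
  have h0 := hϖ.ne_zero
  set m : ℕ := (a 0 - a 1).toNat with hm
  have hm' : (m : ℤ) = a 0 - a 1 := Int.toNat_of_nonneg (sub_nonneg.2 (ha (Fin.zero_le (1 : Fin 2))))
  -- `ϖ^a = ϖ^{(a₀,a₀)} · (ϖ^{(0,m)})⁻¹`
  have hfac : (zpowDiagGL h0 a : GL (Fin 2) E) = zpowDiagGL h0 (fun _ : Fin 2 => a 0) * (zpowDiagGL h0 ![(0 : ℤ), (m : ℤ)])⁻¹ := by
    rw [← zpowDiagGL_neg, ← zpowDiagGL_add]
    congr 1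
    funext i
    fin_cases i
    · simp
    · simp only [Fin.mk_one, Pi.add_apply, Pi.neg_apply, Matrix.cons_val_one, Matrix.cons_val_fin_one, hm']
      ring
  rw [hfac, zpowDiagGL_const_eq_map_scalar, glVertexAct_scalar_mul]
  have e := TreeLayers.dist_iso_apply (glTreeIso hϖ (zpowDiagGL h0 ![(0 : ℤ), (m : ℤ)])) v₀
    (glVertexAct hϖ (zpowDiagGL h0 ![(0 : ℤ), (m : ℤ)])⁻¹ v₀)
  rw [glTreeIso_apply, glTreeIso_apply, ← glVertexAct_mul, mul_inv_cancel, glVertexAct_one] at e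
  rw [← e, SimpleGraph.dist_comm]
  exact dist_root_glVertexAct_zpowDiagGL_zero_nat hϖ v₀ hv₀ m

include hϖ in
/-- **SPHERES = CARTAN SHELLS ON THE TREE OF `GL₂(E)`**: if `k₁ g k₂ = ϖ^a` with `k₁, k₂ ∈ GL₂(𝒪)` and `a` antitone (★ `exists_glInt_mul_mul_eq_zpowDiagGL`: every `g`
has such Cartan data, unique by ★ `cartanExponents_unique`), then `d(v₀, g • v₀) = a₀ − a₁` — `GL₂(𝒪)` fixes `v₀` (★ `glVertexAct_root_eq_of_mem_glInt`) and acts by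
isometries.  Hence `g ∈ E^× · K̃ diag(1, ϖⁿ) K̃ ⟺ d(v₀, g • v₀) = n`: the Hecke shell of `𝟙_{K̃ ϖ^a K̃}` is the sphere of radius `a₀ − a₁` of the `(q_E+1)`-regular tree.
[cite: Serre1980Trees, Ch. II §1.1 Thm. 1] [cite: CartierCorvallis1979, §IV.2] -/
theorem dist_root_glVertexAct_of_mul_mul_eq_zpowDiagGL
    (v₀ : {M : Submodule 𝒪[E] (Fin 2 → E) // IsSpecialLattice (RingHom.id E) ϖ !![(0 : E), 1; -1, 0] M})
    (hv₀ : v₀.1 = latt (1 : Matrix (Fin 2) (Fin 2) E)) {g k₁ k₂ : GL (Fin 2) E} {a : Fin 2 → ℤ}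
    (hk₁ : k₁ ∈ glInt 2 E) (hk₂ : k₂ ∈ glInt 2 E) (ha : Antitone a) (h : k₁ * g * k₂ = zpowDiagGL hϖ.ne_zero a) :
    (latticeTree (RingHom.id E) ϖ !![(0 : E), 1; -1, 0]).dist v₀ (glVertexAct hϖ g v₀) = (a 0 - a 1).toNat := by
  have hg : g = k₁⁻¹ * zpowDiagGL hϖ.ne_zero a * k₂⁻¹ := by
    rw [← h]
    group
  have e := TreeLayers.dist_iso_apply (glTreeIso hϖ k₁⁻¹) v₀ (glVertexAct hϖ (zpowDiagGL hϖ.ne_zero a) v₀)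
  rw [glTreeIso_apply, glTreeIso_apply, glVertexAct_root_eq_of_mem_glInt hϖ (inv_mem hk₁) v₀ hv₀] at e
  rw [hg, glVertexAct_mul, glVertexAct_mul, glVertexAct_root_eq_of_mem_glInt hϖ (inv_mem hk₂) v₀ hv₀, e]
  exact dist_root_glVertexAct_zpowDiagGL hϖ v₀ hv₀ ha

include hϖ in
/-- **EVERY VERTEX `g • v₀` LIES ON THE SPHERE OF RADIUS `a₀ − a₁`** for the Cartan exponents `a` of `g` (★ `exists_glInt_mul_mul_eq_zpowDiagGL` + the dictionary).
[cite: Serre1980Trees, Ch. II §1.1 Thm. 1] [cite: CartierCorvallis1979, §IV.2] -/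
theorem exists_antitone_dist_root_glVertexAct_eq
    (v₀ : {M : Submodule 𝒪[E] (Fin 2 → E) // IsSpecialLattice (RingHom.id E) ϖ !![(0 : E), 1; -1, 0] M})
    (hv₀ : v₀.1 = latt (1 : Matrix (Fin 2) (Fin 2) E)) (g : GL (Fin 2) E) :
    ∃ a : Fin 2 → ℤ, Antitone a ∧ (∃ k₁ ∈ glInt 2 E, ∃ k₂ ∈ glInt 2 E, k₁ * g * k₂ = zpowDiagGL hϖ.ne_zero a) ∧
      (latticeTree (RingHom.id E) ϖ !![(0 : E), 1; -1, 0]).dist v₀ (glVertexAct hϖ g v₀) = (a 0 - a 1).toNat := by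
  obtain ⟨k₁, hk₁, k₂, hk₂, a, ha, h⟩ := exists_glInt_mul_mul_eq_zpowDiagGL hϖ g
  exact ⟨a, ha, ⟨k₁, hk₁, k₂, hk₂, h⟩, dist_root_glVertexAct_of_mul_mul_eq_zpowDiagGL hϖ v₀ hv₀ hk₁ hk₂ ha h⟩

end Spheres

/-! ## §2 The twisted displacement map `τ_δ = δ• ∘ θ̄` -/

section Root

variable (σ : E →+* E) (hσv : ∀ x : E, valuation E (σ x) = valuation E x) (hσσ : ∀ x : E, σ (σ x) = x)

/-- **`θ̄` FIXES THE ROOT** `v₀ = [𝒪²]` (`𝒪² = latt 1` is `w`-self-dual: `w = (0 1; 1 0)` is unimodular; ★ (T.5) `thetaTreeIso_eq_self_iff`).  No DVR hypothesis.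
[cite: Rogawski1990, §4.11 pp. 58–60] [cite: Serre1980Trees, Ch. II §1.1] -/
theorem thetaTreeIso_root
    (v₀ : {M : Submodule 𝒪[E] (Fin 2 → E) // IsSpecialLattice (RingHom.id E) ϖ !![(0 : E), 1; -1, 0] M})
    (hv₀ : v₀.1 = latt (1 : Matrix (Fin 2) (Fin 2) E)) :
    thetaTreeIso hϖ σ hσv hσσ v₀ = v₀ := by
  refine (thetaTreeIso_eq_self_iff hϖ σ hσv hσσ v₀).2 (Or.inl ⟨1, by rw [Units.val_one]; exact hv₀, ?_⟩)
  have h1 : formCongr σ (1 : GL (Fin 2) E) !![(0 : E), 1; 1, 0] = !![(0 : E), 1; 1, 0] := by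
    simp only [formCongr, Units.val_one, Matrix.map_one σ (map_zero σ) (map_one σ), Matrix.transpose_one, Matrix.one_mul, Matrix.mul_one]
  rw [h1]
  refine ⟨fun i j => ?_, ?_⟩
  · fin_cases i <;> fin_cases j <;> simp
  · rw [Matrix.det_fin_two_of]
    simp

/-- `τ_δ` as a graph automorphism, unfolded: `((θ̄).trans (glTreeIso hϖ δ)) M = δ • θ̄ M`. [cite: Serre1980Trees, Ch. II §1.2–§1.3] -/
theorem thetaTreeIso_trans_glTreeIso_apply [IsDiscreteValuationRing 𝒪[E]] (δ : GL (Fin 2) E)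
    (M : {M : Submodule 𝒪[E] (Fin 2 → E) // IsSpecialLattice (RingHom.id E) ϖ !![(0 : E), 1; -1, 0] M}) :
    ((thetaTreeIso hϖ σ hσv hσσ).trans (glTreeIso hϖ δ)) M = glVertexAct hϖ δ (thetaTreeIso hϖ σ hσv hσσ M) := rfl

end Root

section Twisted

variable [IsDiscreteValuationRing 𝒪[E]] (σ : E →+* E) (hσv : ∀ x : E, valuation E (σ x) = valuation E x) (hσσ : ∀ x : E, σ (σ x) = x)

/-- **`τ_δ² = (δ · Θδ)•` — THE SQUARE OF THE TWISTED DISPLACEMENT MAP IS THE ACTION OF THE NORM `Nδ = δΘ(δ)`** (★ (T.4) semiconjugation + ★ (T.3) `θ̄² = 1`).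
[cite: Rogawski1990, §4.11 pp. 58–60] [cite: Langlands1980AMS96, §5] -/
theorem glVertexAct_thetaTreeIso_glVertexAct_thetaTreeIso (δ : GL (Fin 2) E)
    (M : {M : Submodule 𝒪[E] (Fin 2 → E) // IsSpecialLattice (RingHom.id E) ϖ !![(0 : E), 1; -1, 0] M}) :
    glVertexAct hϖ δ (thetaTreeIso hϖ σ hσv hσσ (glVertexAct hϖ δ (thetaTreeIso hϖ σ hσv hσσ M))) =
      glVertexAct hϖ (δ * UnitaryGroup.qsInvolution σ δ) M := by
  rw [thetaTreeIso_glVertexAct, thetaTreeIso_thetaTreeIso, ← glVertexAct_mul]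

/-- **EQUIVARIANCE `τ_δ (g • M) = (δ Θ(g) δ⁻¹) • τ_δ M`** — `τ_δ` intertwines `g•` with the `δ`-twisted conjugate of `Θ(g)`; in particular the twisted centraliser
`{g : g δ Θ(g)⁻¹ = δ}` commutes with `τ_δ`. [cite: Rogawski1990, §4.11 pp. 58–60] [cite: Langlands1980AMS96, §5] -/
theorem glVertexAct_thetaTreeIso_glVertexAct (δ g : GL (Fin 2) E)
    (M : {M : Submodule 𝒪[E] (Fin 2 → E) // IsSpecialLattice (RingHom.id E) ϖ !![(0 : E), 1; -1, 0] M}) :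
    glVertexAct hϖ δ (thetaTreeIso hϖ σ hσv hσσ (glVertexAct hϖ g M)) =
      glVertexAct hϖ (δ * UnitaryGroup.qsInvolution σ g * δ⁻¹) (glVertexAct hϖ δ (thetaTreeIso hϖ σ hσv hσσ M)) := by
  rw [thetaTreeIso_glVertexAct, ← glVertexAct_mul, ← glVertexAct_mul, inv_mul_cancel_right]

/-- **THE TWISTED DISPLACEMENT OF `g • v₀` IS THE LEVEL OF `g⁻¹ δ Θ(g)`**: `d(g•v₀, τ_δ(g•v₀)) = d(v₀, (g⁻¹ δ Θ(g)) • v₀)` (`θ̄ v₀ = v₀`, `g⁻¹•` is an isometry,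
★ `TreeLayers.dist_iso_apply`).  This is the tree form of `TO_{δθ}(f) = ∫ f(g⁻¹ δ θ(g))`. [cite: Rogawski1990, §4.11 pp. 58–60] [cite: Langlands1980AMS96, §5] -/
theorem dist_glVertexAct_root_glVertexAct_thetaTreeIso (δ g : GL (Fin 2) E)
    (v₀ : {M : Submodule 𝒪[E] (Fin 2 → E) // IsSpecialLattice (RingHom.id E) ϖ !![(0 : E), 1; -1, 0] M})
    (hv₀ : v₀.1 = latt (1 : Matrix (Fin 2) (Fin 2) E)) :
    (latticeTree (RingHom.id E) ϖ !![(0 : E), 1; -1, 0]).dist (glVertexAct hϖ g v₀)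
        (glVertexAct hϖ δ (thetaTreeIso hϖ σ hσv hσσ (glVertexAct hϖ g v₀))) =
      (latticeTree (RingHom.id E) ϖ !![(0 : E), 1; -1, 0]).dist v₀ (glVertexAct hϖ (g⁻¹ * δ * UnitaryGroup.qsInvolution σ g) v₀) := by
  rw [thetaTreeIso_glVertexAct, thetaTreeIso_root hϖ σ hσv hσσ v₀ hv₀, ← glVertexAct_mul]
  have e := TreeLayers.dist_iso_apply (glTreeIso hϖ g⁻¹) (glVertexAct hϖ g v₀) (glVertexAct hϖ (δ * UnitaryGroup.qsInvolution σ g) v₀)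
  rw [glTreeIso_apply, glTreeIso_apply, ← glVertexAct_mul, ← glVertexAct_mul, inv_mul_cancel, glVertexAct_one] at e
  rw [← e, mul_assoc]

/-- **THE TWISTED SHELL DICTIONARY (rank one, tree edition of ★ W9-c)**: if `k₁ (g⁻¹ δ Θ(g)) k₂ = ϖ^a` (`kᵢ ∈ GL₂(𝒪)`, `a` antitone) then
`d(g•v₀, τ_δ(g•v₀)) = a₀ − a₁` — the vertices counted by `TO_{δθ}(𝟙_{K̃ ϖ^a K̃})` are exactly the `x = g•v₀` displaced by `τ_δ` by `a₀ − a₁` (the other exponent is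
forced: `a₀ + a₁ = ord det(g⁻¹δΘg) = ord det δ − 2 ord det g`, as `ord det Θ(g) = −ord det g`). [cite: Rogawski1990, §4.11 pp. 58–60] [cite: Langlands1980AMS96, §5] [cite: CartierCorvallis1979, §IV.2] -/
theorem dist_glVertexAct_thetaTreeIso_of_mul_mul_eq_zpowDiagGL (δ g : GL (Fin 2) E)
    (v₀ : {M : Submodule 𝒪[E] (Fin 2 → E) // IsSpecialLattice (RingHom.id E) ϖ !![(0 : E), 1; -1, 0] M})
    (hv₀ : v₀.1 = latt (1 : Matrix (Fin 2) (Fin 2) E)) {k₁ k₂ : GL (Fin 2) E} {a : Fin 2 → ℤ}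
    (hk₁ : k₁ ∈ glInt 2 E) (hk₂ : k₂ ∈ glInt 2 E) (ha : Antitone a)
    (h : k₁ * (g⁻¹ * δ * UnitaryGroup.qsInvolution σ g) * k₂ = zpowDiagGL hϖ.ne_zero a) :
    (latticeTree (RingHom.id E) ϖ !![(0 : E), 1; -1, 0]).dist (glVertexAct hϖ g v₀)
        (glVertexAct hϖ δ (thetaTreeIso hϖ σ hσv hσσ (glVertexAct hϖ g v₀))) = (a 0 - a 1).toNat := by
  rw [dist_glVertexAct_root_glVertexAct_thetaTreeIso hϖ σ hσv hσσ δ g v₀ hv₀]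
  exact dist_root_glVertexAct_of_mul_mul_eq_zpowDiagGL hϖ v₀ hv₀ hk₁ hk₂ ha h

/-! ## §3 The elliptic twisted shell count (★ W8-f at `α = τ_δ`) -/

/-- **ODD TWISTED SHELLS ARE EMPTY when `τ_δ` fixes a vertex**: `{x | d(x, τ_δ x) = 2k+1} = ∅` (`d(x, τ_δ x) = 2·d(x, Fix τ_δ)`, ★ `TreeDisplacement.exists_height_parent`
on the tree ★ `isTree_latticeTree_id_altJ`). [cite: Serre1980Trees, Ch. I §6.4 Prop. 24] -/
theorem setOf_dist_glVertexAct_thetaTreeIso_eq_odd (δ : GL (Fin 2) E)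
    {u : {M : Submodule 𝒪[E] (Fin 2 → E) // IsSpecialLattice (RingHom.id E) ϖ !![(0 : E), 1; -1, 0] M}}
    (hu : glVertexAct hϖ δ (thetaTreeIso hϖ σ hσv hσσ u) = u) (k : ℕ) :
    {x : {M : Submodule 𝒪[E] (Fin 2 → E) // IsSpecialLattice (RingHom.id E) ϖ !![(0 : E), 1; -1, 0] M} |
        (latticeTree (RingHom.id E) ϖ !![(0 : E), 1; -1, 0]).dist x (glVertexAct hϖ δ (thetaTreeIso hϖ σ hσv hσσ x)) = 2 * k + 1} = ∅ := by
  obtain ⟨h, -, -, -, -, -, -, hdisp⟩ := TreeDisplacement.exists_height_parent (isTree_latticeTree_id_altJ hϖ)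
    ((thetaTreeIso hϖ σ hσv hσσ).trans (glTreeIso hϖ δ)) (u := u) hu
  refine Set.eq_empty_of_forall_notMem fun x hx => ?_
  rw [Set.mem_setOf_eq] at hx
  have hx' := hdisp x
  rw [thetaTreeIso_trans_glTreeIso_apply] at hx'
  omega

/-- **THE ELLIPTIC TWISTED SHELL COUNT** (★ W8-f `ncard_displaced_eq_of_regular_sum` BY NAME at `α = τ_δ`): if `τ_δ` fixes a vertex `u`, has finitely many fixed vertices, and
every moved vertex has `q + 1` neighbours (VALUE BINDER `hdeg`; `q = q_E`, ★ `SLTwoTreeRegular.ncard_neighborSet_eq`), then for `k ≥ 1`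
`#{x | d(x, τ_δ x) = 2k} = q^{k−1} · Σ_{y ∈ Fix τ_δ} #{w ∈ N(y) | τ_δ w ≠ w}` — the `G̃`-side count of `TO_{δθ}(𝟙_{K̃ ϖ^a K̃})`, `a₀ − a₁ = 2k`, relative to the fixed
subtree `Fix τ_δ` (inside the `U(1,1)_δ` tree, «tree in tree»). [cite: Rogawski1990, §4.11 pp. 58–60] [cite: Langlands1980AMS96, §5] [cite: Serre1980Trees, Ch. I §6.4 Prop. 24] -/
theorem ncard_setOf_dist_glVertexAct_thetaTreeIso_eq_two_mul
    [DecidableEq {M : Submodule 𝒪[E] (Fin 2 → E) // IsSpecialLattice (RingHom.id E) ϖ !![(0 : E), 1; -1, 0] M}]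
    [(latticeTree (RingHom.id E) ϖ !![(0 : E), 1; -1, 0]).LocallyFinite] (δ : GL (Fin 2) E)
    {u : {M : Submodule 𝒪[E] (Fin 2 → E) // IsSpecialLattice (RingHom.id E) ϖ !![(0 : E), 1; -1, 0] M}}
    (hu : glVertexAct hϖ δ (thetaTreeIso hϖ σ hσv hσσ u) = u)
    (hfin : {v : {M : Submodule 𝒪[E] (Fin 2 → E) // IsSpecialLattice (RingHom.id E) ϖ !![(0 : E), 1; -1, 0] M} |
      glVertexAct hϖ δ (thetaTreeIso hϖ σ hσv hσσ v) = v}.Finite)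
    (q : ℕ) (hdeg : ∀ v : {M : Submodule 𝒪[E] (Fin 2 → E) // IsSpecialLattice (RingHom.id E) ϖ !![(0 : E), 1; -1, 0] M},
      glVertexAct hϖ δ (thetaTreeIso hϖ σ hσv hσσ v) ≠ v → (latticeTree (RingHom.id E) ϖ !![(0 : E), 1; -1, 0]).degree v = q + 1)
    {k : ℕ} (hk : 1 ≤ k) :
    {x : {M : Submodule 𝒪[E] (Fin 2 → E) // IsSpecialLattice (RingHom.id E) ϖ !![(0 : E), 1; -1, 0] M} |
        (latticeTree (RingHom.id E) ϖ !![(0 : E), 1; -1, 0]).dist x (glVertexAct hϖ δ (thetaTreeIso hϖ σ hσv hσσ x)) = 2 * k}.ncard =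
      q ^ (k - 1) * ∑ y ∈ hfin.toFinset,
        (((latticeTree (RingHom.id E) ϖ !![(0 : E), 1; -1, 0]).neighborFinset y).filter
          (fun w => glVertexAct hϖ δ (thetaTreeIso hϖ σ hσv hσσ w) ≠ w)).card :=
  ncard_displaced_eq_of_regular_sum (isTree_latticeTree_id_altJ hϖ) ((thetaTreeIso hϖ σ hσv hσσ).trans (glTreeIso hϖ δ)) hu hfin q hdeg hk

end Twisted

end Summit.HodgeConjecture.HodgeConjecture.R90.S6

end
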